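import Mathlib
import Summits.Ventures.HodgeRepro2.Tier7.Common.CurveAlg

/-!
# Tier7/Datum/CurveTensor — the «abelian-surface shape» `A ⊗ A'`: two curve algebras, the antilinear swap, the integral
(t7-L1-p1; for the NON-VACUITY DATUM `datumA`, t7-lead l. 14651 (B) / plan-1 l. 14811)

Generic over a complex vector space `V` with a real structure `ρ` (an antilinear additive involution) and a bilinear form
`β`: `A := CurveAlg ℂ V β` (p4's `Tier7/Common/CurveAlg.lean`: `ℂ ⊕ V ⊕ ℂ·t`, `v·v' = β(v,v')·t`), `A' := CurveAlg ℂ V β'`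
with the conjugate form `β'(v, w) = conj β(ρ v, ρ w)`, `HXA := A ⊗[ℂ] A'` (Mathlib's `Algebra.TensorProduct`: a ring and
a ℂ-algebra), `bar : HXA → HXA` the ANTILINEAR SWAP `x ⊗ y ↦ conj' y ⊗ conj x` (built through `TensorProduct.lift` into
the conjugate module `Conj HXA`; a ring involution), and `∫ := the coefficient of t ⊗ t'` (`intA`, ℂ-linear, with
`∫ bar z = conj ∫ z`). WHY THIS SHAPE (plan-1 l. 14811): the lead's «`ℂ ⊕ V ⊕ V̄ ⊕ ℂw ⊕ ℂw̄ ⊕ ℂ·top` with `V·V̄ = 0`» is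
not associative (`(v₁v₂)(v̄₁v̄₂) = ββ̄·top` but `v₁(v₂(v̄₁v̄₂)) = 0` when `V·w̄ = 0`); the tensor product of two curve
algebras is the honest minimal associative model with `H^{1,0}·H^{1,0}` a line and `w·w̄ ≠ 0`.
Nothing here is a fact about the surface: it is a carrier. §8(d): NO. Author: t7-L1-p1.
-/

/-! ## Part A — the generic «abelian-surface shape»: the tensor product of two curve algebras, its antilinear
swap, its top functional (t7-L1-p1) -/

namespace Summit.Ventures.HodgeRepro2.Tier7.DatumA

open Summit.Ventures.HodgeRepro2.Tier7
open scoped TensorProduct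

noncomputable section

/-- the conjugate ℂ-module of `M` (a wrapper): `c • ⟨x⟩ = ⟨conj c • x⟩` -/
structure Conj (M : Type) where
  /-- the underlying vector -/
  val : M

/-- the additive equivalence `Conj M ≃ M` -/
def Conj.equiv (M : Type) : Conj M ≃ M where
  toFun := Conj.val
  invFun := Conj.mk
  left_inv _ := rfl
  right_inv _ := rfl

/-- the additive group of the conjugate module (transported along `Conj.equiv`) -/
instance (M : Type) [AddCommGroup M] : AddCommGroup (Conj M) := (Conj.equiv M).addCommGroup

/-- `val` is additive -/
@[simp] theorem Conj.val_add {M : Type} [AddCommGroup M] (x y : Conj M) : (x + y).val = x.val + y.val := rfl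
/-- `val 0 = 0` -/
@[simp] theorem Conj.val_zero {M : Type} [AddCommGroup M] : (0 : Conj M).val = 0 := rfl

/-- the conjugate scalar action `c • ⟨x⟩ = ⟨conj c • x⟩` -/
instance (M : Type) [AddCommGroup M] [Module ℂ M] : SMul ℂ (Conj M) :=
  ⟨fun c x => ⟨((starRingEnd ℂ) c) • x.val⟩⟩

/-- `val` of a conjugate scalar multiple -/
@[simp] theorem Conj.val_smul {M : Type} [AddCommGroup M] [Module ℂ M] (c : ℂ) (x : Conj M) :
    (c • x).val = ((starRingEnd ℂ) c) • x.val := rfl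

/-- extensionality for the wrapper -/
theorem Conj.ext' {M : Type} {x y : Conj M} (h : x.val = y.val) : x = y := by
  cases x; cases y; cases h; rfl

/-- the conjugate ℂ-module structure -/
instance (M : Type) [AddCommGroup M] [Module ℂ M] : Module ℂ (Conj M) where
  one_smul x := Conj.ext' (by simp)
  mul_smul a b x := Conj.ext' (by simp [mul_smul])
  smul_zero a := Conj.ext' (by simp)
  smul_add a x y := Conj.ext' (by simp [smul_add])
  add_smul a b x := Conj.ext' (by simp [add_smul])
  zero_smul x := Conj.ext' (by simp)

/-- the identity, `M → Conj M` -/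
def toConj {M : Type} (x : M) : Conj M := ⟨x⟩

/-- the identity, `Conj M → M` -/
def ofConj {M : Type} (x : Conj M) : M := x.val

/-- `toConj` turns `conj c •` into `c •` -/
theorem toConj_smul {M : Type} [AddCommGroup M] [Module ℂ M] (c : ℂ) (x : M) :
    toConj (((starRingEnd ℂ) c) • x) = c • toConj x := rfl

/-- `toConj` is additive -/
theorem toConj_add {M : Type} [AddCommGroup M] [Module ℂ M] (x y : M) :
    toConj (x + y) = toConj x + toConj y := rfl

/-- `ofConj` turns `c •` into `conj c •` -/
theorem ofConj_smul {M : Type} [AddCommGroup M] [Module ℂ M] (c : ℂ) (x : Conj M) :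
    ofConj (c • x) = ((starRingEnd ℂ) c) • ofConj x := rfl

/-- `ofConj` is additive -/
theorem ofConj_add {M : Type} [AddCommGroup M] [Module ℂ M] (x y : Conj M) :
    ofConj (x + y) = ofConj x + ofConj y := rfl

/-- `ofConj 0 = 0` -/
theorem ofConj_zero {M : Type} [AddCommGroup M] : ofConj (0 : Conj M) = 0 := rfl

/-- a real structure on a complex vector space: an antilinear additive involution -/
structure RealStr (V : Type) [AddCommGroup V] [Module ℂ V] where
  bar : V →+ V
  bar_smul : ∀ (c : ℂ) (v : V), bar (c • v) = ((starRingEnd ℂ) c) • bar v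
  bar_bar : ∀ v, bar (bar v) = v

section Generic

variable {V : Type} [AddCommGroup V] [Module ℂ V] (ρ : RealStr V) (β : V →ₗ[ℂ] V →ₗ[ℂ] ℂ)

/-- the conjugate bilinear form `β'(v, w) = conj β(bar v, bar w)` -/
def betaConj : V →ₗ[ℂ] V →ₗ[ℂ] ℂ :=
  LinearMap.mk₂ ℂ (fun v w => (starRingEnd ℂ) (β (ρ.bar v) (ρ.bar w)))
    (fun v v' w => by rw [map_add, map_add, LinearMap.add_apply, map_add])
    (fun c v w => by
      rw [ρ.bar_smul, map_smul, LinearMap.smul_apply, smul_eq_mul, map_mul, Complex.conj_conj]; rfl)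
    (fun v w w' => by rw [map_add, map_add, map_add])
    (fun c v w => by rw [ρ.bar_smul, map_smul, smul_eq_mul, map_mul, Complex.conj_conj]; rfl)

/-- the value of the conjugate form -/
theorem betaConj_apply (v w : V) : betaConj ρ β v w = (starRingEnd ℂ) (β (ρ.bar v) (ρ.bar w)) := rfl

/-- `A = CurveAlg ℂ V β` (the holomorphic factor) -/
abbrev Ahol := CurveAlg ℂ V β
/-- `A' = CurveAlg ℂ V β'` (the antiholomorphic factor) -/
abbrev Aanti := CurveAlg ℂ V (betaConj ρ β)

/-- conjugation `A → A'`, `(r, v, a) ↦ (conj r, bar v, conj a)` (a ring map by the definition of `β'`) -/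
def conjHol : Ahol β →+* Aanti ρ β :=
  CurveAlg.map (starRingEnd ℂ) ρ.bar ρ.bar_smul (fun v w => by rw [betaConj_apply, ρ.bar_bar, ρ.bar_bar])

/-- conjugation `A' → A` -/
def conjAnti : Aanti ρ β →+* Ahol β :=
  CurveAlg.map (starRingEnd ℂ) ρ.bar ρ.bar_smul (fun v w => by rw [betaConj_apply, Complex.conj_conj])

/-- `conj' ∘ conj = id` -/
theorem conjAnti_conjHol (x : Ahol β) : conjAnti ρ β (conjHol ρ β x) = x := by
  ext <;> simp [conjAnti, conjHol, ρ.bar_bar]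

/-- `conj ∘ conj' = id` -/
theorem conjHol_conjAnti (x : Aanti ρ β) : conjHol ρ β (conjAnti ρ β x) = x := by
  ext <;> simp [conjAnti, conjHol, ρ.bar_bar]

/-- `conj` is antilinear -/
theorem conjHol_smul (c : ℂ) (x : Ahol β) : conjHol ρ β (c • x) = (starRingEnd ℂ c) • conjHol ρ β x := by
  ext <;> simp [conjHol, ρ.bar_smul]

/-- `conj'` is antilinear -/
theorem conjAnti_smul (c : ℂ) (x : Aanti ρ β) : conjAnti ρ β (c • x) = (starRingEnd ℂ c) • conjAnti ρ β x := by
  ext <;> simp [conjAnti, ρ.bar_smul]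

/-- `conj t = t'` -/
theorem conjHol_t : conjHol ρ β CurveAlg.t = CurveAlg.t := by
  ext <;> simp [conjHol]

/-- `conj' t' = t` -/
theorem conjAnti_t : conjAnti ρ β CurveAlg.t = CurveAlg.t := by
  ext <;> simp [conjAnti]

/-- `top ∘ conj = conj ∘ top` -/
theorem top_conjHol (x : Ahol β) : CurveAlg.top (conjHol ρ β x) = (starRingEnd ℂ) (CurveAlg.top x) := rfl

/-- `top ∘ conj' = conj ∘ top` -/
theorem top_conjAnti (x : Aanti ρ β) : CurveAlg.top (conjAnti ρ β x) = (starRingEnd ℂ) (CurveAlg.top x) := rfl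

/-- **the abelian-surface shape** `HXA = A ⊗ A'` -/
abbrev HXA := Ahol β ⊗[ℂ] Aanti ρ β

/-- the bilinear map `(x, y) ↦ conj' y ⊗ conj x` into the conjugate module -/
def barBil : Ahol β →ₗ[ℂ] Aanti ρ β →ₗ[ℂ] Conj (HXA ρ β) :=
  LinearMap.mk₂ ℂ (fun x y => toConj (conjAnti ρ β y ⊗ₜ[ℂ] conjHol ρ β x))
    (fun x x' y => by rw [map_add, TensorProduct.tmul_add]; rfl)
    (fun c x y => by rw [conjHol_smul, TensorProduct.tmul_smul, toConj_smul])
    (fun x y y' => by rw [map_add, TensorProduct.add_tmul]; rfl)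
    (fun c x y => by rw [conjAnti_smul, ← TensorProduct.smul_tmul', toConj_smul])

/-- **complex conjugation on `HXA`**: the antilinear swap `x ⊗ y ↦ conj' y ⊗ conj x` -/
def barA (z : HXA ρ β) : HXA ρ β :=
  ofConj (TensorProduct.lift (barBil ρ β) z)

/-- `bar` on pure tensors: the antilinear swap -/
theorem barA_tmul (x : Ahol β) (y : Aanti ρ β) :
    barA ρ β (x ⊗ₜ[ℂ] y) = conjAnti ρ β y ⊗ₜ[ℂ] conjHol ρ β x := by
  unfold barA
  rw [TensorProduct.lift.tmul]
  rfl

/-- `bar 0 = 0` -/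
theorem barA_zero : barA ρ β 0 = 0 := by
  unfold barA
  rw [map_zero, ofConj_zero]

/-- `bar` is additive -/
theorem barA_add (z w : HXA ρ β) : barA ρ β (z + w) = barA ρ β z + barA ρ β w := by
  unfold barA
  rw [map_add, ofConj_add]

/-- `bar` is antilinear -/
theorem barA_smul (c : ℂ) (z : HXA ρ β) : barA ρ β (c • z) = (starRingEnd ℂ c) • barA ρ β z := by
  unfold barA
  rw [map_smul, ofConj_smul]

/-- `bar` is multiplicative -/
theorem barA_mul (z w : HXA ρ β) : barA ρ β (z * w) = barA ρ β z * barA ρ β w := by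
  induction z using TensorProduct.induction_on with
  | zero => rw [zero_mul, barA_zero, zero_mul]
  | tmul x y =>
    induction w using TensorProduct.induction_on with
    | zero => rw [mul_zero, barA_zero, mul_zero]
    | tmul x' y' =>
      rw [Algebra.TensorProduct.tmul_mul_tmul, barA_tmul, barA_tmul, barA_tmul,
        Algebra.TensorProduct.tmul_mul_tmul, RingHom.map_mul, RingHom.map_mul]
    | add w₁ w₂ h₁ h₂ => rw [mul_add, barA_add, h₁, h₂, barA_add, mul_add]
  | add z₁ z₂ h₁ h₂ => rw [add_mul, barA_add, h₁, h₂, barA_add, add_mul]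

/-- `bar` is an involution -/
theorem barA_barA (z : HXA ρ β) : barA ρ β (barA ρ β z) = z := by
  induction z using TensorProduct.induction_on with
  | zero => rw [barA_zero, barA_zero]
  | tmul x y => rw [barA_tmul, barA_tmul, conjHol_conjAnti, conjAnti_conjHol]
  | add z₁ z₂ h₁ h₂ => rw [barA_add, barA_add, h₁, h₂]

/-- **the integral** `∫ : HXA → ℂ`, the coefficient of `t ⊗ t'` -/
def intA : HXA ρ β →ₗ[ℂ] ℂ :=
  TensorProduct.lift ((LinearMap.mul ℂ ℂ).compl₁₂ CurveAlg.top CurveAlg.top)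

/-- `∫ (x ⊗ y) = top x · top y` -/
theorem intA_tmul (x : Ahol β) (y : Aanti ρ β) :
    intA ρ β (x ⊗ₜ[ℂ] y) = CurveAlg.top x * CurveAlg.top y := by
  simp [intA]

/-- `∫ bar z = conj ∫ z` -/
theorem intA_barA (z : HXA ρ β) : intA ρ β (barA ρ β z) = (starRingEnd ℂ) (intA ρ β z) := by
  induction z using TensorProduct.induction_on with
  | zero => rw [barA_zero, map_zero, map_zero]
  | tmul x y => rw [barA_tmul, intA_tmul, intA_tmul, top_conjAnti, top_conjHol, map_mul, mul_comm]
  | add z₁ z₂ h₁ h₂ => rw [barA_add, map_add, h₁, h₂, map_add, map_add]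

end Generic

end

end Summit.Ventures.HodgeRepro2.Tier7.DatumA
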